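/-
Copyright (c) 2026 the pub-hodgecm-mathlib formalisation cell (harness21).  Prover seat hodgecm-mathlib-K2E3-p26 (g2), Track B «K2-LIT» (valve hand → L1),
#184♮ = hLiu418 = `stmt-HodgeConjecture-24832`; socket #41, KIND 1, organ (K1b-W) «KIND W at `n := 1` for the pulled-back family» (line lead K2Liu-p14 (g4), FILE CUT
2026-09-04T22:32:01Z, LINE WORDS #1 (3) ∕ #5), brick (KW1-c) sub-brick (c4) «THE LATTICE LETTER AT A BAD PLACE, RANK ONE» (edition 1: the coordinate core).
THEOREMS ONLY (no `def`, no `instance`, no notation, no named-fact hypothesis, no `sorry`); lane `--supports stmt-HodgeConjecture-24832` (count-neutral helper; closes no socket by itself).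
-/
import Summits.HodgeConjecture.HodgeConjecture.Theorems.K2LiuCharacterTrivialBallNormBound   -- ★ (c2) p862738 (this seat): `v_le_exp_of_forall_apply_mul_eq_one` (character trivial on `𝔭^n` ⟹ `|ξ|_v ≤ exp(n − d)`)
import Mathlib.MeasureTheory.Group.Integral
import Mathlib.MeasureTheory.Integral.Bochner.Set
import HarnessLib

/-!
# Crux `HLiu418`, socket #41, (K1b-W) brick (KW1-c) sub-brick (c4) — `K2LiuKindOneLineLatticeLetter` (edition 1): THE RANK-ONE LATTICE LETTER — a twisted integral
# `∫ Φ(b)·ψ(b·ξ) db` over `L⁺_v` of a `𝔭^m`-TRANSLATION-INVARIANT `Φ` VANISHES UNLESS `|ξ|_v ≤ exp(m − d)` (`d` = conductor exponent of `ψ`)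

Cell `hodgecm-mathlib`, crux item hLiu418 = `stmt-HodgeConjecture-24832` (helper lane `--supports … --as helper`, count-neutral), route of record `HCCMUnconditional`;
squad K2 ∕ K2Liu (L1, LEAD F0P6-plan (g14) BATCH #79∕#82), road `K2_Liu`, socket #41, KIND 1, organ (K1b-W) (line lead K2Liu-p14 (g4)), brick (KW1-c): (c1) ★ p862721
`K2LiuLocalHeightLevelConjugation` · (c2) ★ p862738 `K2LiuCharacterTrivialBallNormBound` · HEAD ★ p862891 `K2LiuKindOneLineWhittakerSupport` (`hsupp₁` from the by-value per-place
letter `hlat`) · THIS FILE (c4) = the payer-side core of `hlat` at a bad place, in the RANK-ONE COORDINATE `b ∈ L⁺_v` of the line (★ `K2LiuUnipDeltaRankOneHaar`, ★∕📤 (KW1-b2)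
`K2LiuKindOneLineGoodPlaceFactor`: the `n = 1` local Whittaker integral is `∫_{L⁺_v} f(w₁·n(t(b))·g_v)·ψ_v(b·ξ) db`, the twist read by (KW1-b2′) `K2LiuKindOneLineCharacterReading`).
Author K2E3-p26 (g2).

THE MATHEMATICS (Casselman's lattice-support argument in one variable [Casselman1980, §3]; [Shimura1997, §18]; [Tate1950, §2.2]).  Let `Φ : L⁺_v → ℂ` be invariant under the
translations `b ↦ b + b₀`, `|b₀|_v ≤ exp(−m)` (for the line: `Φ(b) = f_s(w₁·n(t(b))·g_v)`, and `n(t(b + b₀)) = n(t(b))·n(t(b₀))` with `n(t(b₀))` in the right-invariance group of the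
translated section for `b₀ ∈ 𝔭^m`, `m = c_v + 2a`, `q^a = H(g_v)` — ★ (c1) + the corner chart's level clause `hιK` ★ (e2)), `ψ` an additive character of `L⁺_v` of conductor exponent `d`,
`ξ ∈ L⁺_v` the twist.  Substituting `b ↦ b + b₀` in `I = ∫ Φ(b)ψ(bξ) db` (any right-invariant measure) gives `I = ψ(b₀ξ)·I`; so `I ≠ 0` forces `ψ(b₀ξ) = 1` for all `b₀ ∈ 𝔭^m`, whence
`|ξ|_v ≤ exp(m − d)` by ★ (c2).  That is the lattice letter `hlat` of ★ `hsupp_line_of_latticeLetter` up to the (KW1-b2′) reading `ξ = S₀₀·δ` and the dictionary `|·|_v ↔ |·|_w` (edition 2).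
* §1 **`integral_mul_addChar_eq_zero_of_translate`** — `Φ(· + b₀) = Φ`, `ψ(b₀ξ) ≠ 1` ⟹ `∫ Φ(b)ψ(bξ) dμ = 0` (`μ` right-invariant); `addChar_eq_one_of_integral_ne_zero` (contrapositive);
  `setIntegral_mul_addChar_eq_zero_of_translate` — the same over a `b₀`-stable measurable set `B` (Karel's truncation balls).
* §2 **`v_le_exp_of_integral_mul_addChar_ne_zero`** — `Φ` invariant under `𝔭^m`, `ψ` of conductor exponent `d`, `∫ Φ(b)ψ(bξ) dμ ≠ 0` ⟹ `|ξ|_v ≤ exp(m − d)` (★ (c2)); and the ball version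
  `v_le_exp_of_setIntegral_mul_addChar_ne_zero`.

HONEST LABEL.  Count-neutral helper; it retires nothing by itself: `HC_CM` is proved only modulo the 7 printed citations (2 remaining named inputs:
hLiu418 = `stmt-HodgeConjecture-24832`, h413 = `stmt-HodgeConjecture-24833`) until rung 0 closes.

## References
* [Casselman1980] W. Casselman, *The unramified principal series of p-adic groups I*, Compositio Math. 40 (1980), §3 (lattice support of Whittaker functionals).
* [Shimura1997] G. Shimura, *Euler products and Eisenstein series*, CBMS 93 (1997), §18 (local Whittaker integrals of Siegel sections at bad places).
* [Tate1950] J. Tate, *Fourier analysis in number fields and Hecke's zeta-functions* (1950), in Cassels–Fröhlich (1967), Ch. XV §2.2 (conductor, self-duality of `K_v`).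
* [BushnellHenniart2006] C. J. Bushnell, G. Henniart, *The local Langlands conjecture for GL(2)*, Grundlehren 335 (2006), §1.7.
-/

set_option autoImplicit false
-- the mandated namespace repeats the single-problem summit's segment (`HodgeConjecture.HodgeConjecture`)
set_option linter.dupNamespace false

noncomputable section

open scoped NNReal WithZero
open NumberField IsDedekindDomain MeasureTheory
open Literature.NumberTheory.Automorphic

namespace Summit.HodgeConjecture.HodgeConjecture.Cruxes.HLiu418.K2LiuKindOneLineLatticeLetter

open Summit.HodgeConjecture.HodgeConjecture.Cruxes.HLiu418.K2LiuCharacterTrivialBallNormBound (v_le_exp_of_forall_apply_mul_eq_one)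

/-! ## §1 Translation invariance kills the twisted integral unless the character is trivial -/

section Vanishing

variable {F : Type*} [Field F] [MeasurableSpace F] [TopologicalSpace F] [IsTopologicalAddGroup F] [BorelSpace F]
  (μ : Measure F) [μ.IsAddRightInvariant]

omit [MeasurableSpace F] [TopologicalSpace F] [IsTopologicalAddGroup F] [BorelSpace F] in
/-- the twisted integrand after translation: `Φ(b + b₀)·ψ((b + b₀)ξ) = ψ(b₀ξ)·(Φ(b)·ψ(bξ))` when `Φ(b + b₀) = Φ(b)`. [cite: Casselman1980, §3] -/
theorem mul_addChar_add_mul (ψ : AddChar F Circle) (ξ : F) {Φ : F → ℂ} {b₀ : F} (hΦ : ∀ b, Φ (b + b₀) = Φ b) (b : F) :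
    Φ (b + b₀) * ((ψ ((b + b₀) * ξ) : Circle) : ℂ) = ((ψ (b₀ * ξ) : Circle) : ℂ) * (Φ b * ((ψ (b * ξ) : Circle) : ℂ)) := by
  rw [hΦ b, add_mul, AddChar.map_add_eq_mul, Circle.coe_mul]
  ring

/-- **TRANSLATION INVARIANCE KILLS THE TWISTED INTEGRAL**: if `Φ(b + b₀) = Φ(b)` for all `b` and `ψ(b₀·ξ) ≠ 1`, then `∫ Φ(b)·ψ(b·ξ) dμ(b) = 0` for every right-invariant measure
`μ` on the additive group (substitute `b ↦ b + b₀`: `I = ψ(b₀ξ)·I`). [cite: Casselman1980, §3] [cite: Shimura1997, §18] -/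
theorem integral_mul_addChar_eq_zero_of_translate (ψ : AddChar F Circle) (ξ : F) {Φ : F → ℂ} {b₀ : F} (hΦ : ∀ b, Φ (b + b₀) = Φ b)
    (hne : ψ (b₀ * ξ) ≠ 1) : ∫ b, Φ b * ((ψ (b * ξ) : Circle) : ℂ) ∂μ = 0 := by
  have hsub := integral_add_right_eq_self (μ := μ) (fun b => Φ b * ((ψ (b * ξ) : Circle) : ℂ)) b₀
  simp only [mul_addChar_add_mul ψ ξ hΦ] at hsub
  rw [integral_const_mul] at hsub
  -- `ψ(b₀ξ)·I = I` with `ψ(b₀ξ) ≠ 1`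
  have hne' : ((ψ (b₀ * ξ) : Circle) : ℂ) ≠ 1 := fun h => hne (Circle.coe_eq_one.1 h)
  have hI : (((ψ (b₀ * ξ) : Circle) : ℂ) - 1) * ∫ b, Φ b * ((ψ (b * ξ) : Circle) : ℂ) ∂μ = 0 := by rw [sub_mul, one_mul, hsub, sub_self]
  exact (mul_eq_zero.1 hI).resolve_left (sub_ne_zero.2 hne')

/-- **SUPPORT FORM**: a non-zero twisted integral forces `ψ(b₀·ξ) = 1` for every period `b₀` of `Φ`. [cite: Casselman1980, §3] [cite: Shimura1997, §18] -/
theorem addChar_eq_one_of_integral_ne_zero (ψ : AddChar F Circle) (ξ : F) {Φ : F → ℂ} (hI : ∫ b, Φ b * ((ψ (b * ξ) : Circle) : ℂ) ∂μ ≠ 0)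
    {b₀ : F} (hΦ : ∀ b, Φ (b + b₀) = Φ b) : ψ (b₀ * ξ) = 1 := by
  by_contra hne
  exact hI (integral_mul_addChar_eq_zero_of_translate μ ψ ξ hΦ hne)

/-- **THE BALL VERSION** (Karel's truncation): for a measurable `B` stable under `b ↦ b + b₀` (`b + b₀ ∈ B ↔ b ∈ B`), `Φ(· + b₀) = Φ` and `ψ(b₀ξ) ≠ 1` ⟹ `∫_B Φ(b)·ψ(b·ξ) dμ = 0`
(apply the full-integral form to `1_B·Φ`, again `b₀`-periodic). [cite: Casselman1980, §3] [cite: Shimura1997, §18] -/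
theorem setIntegral_mul_addChar_eq_zero_of_translate (ψ : AddChar F Circle) (ξ : F) {Φ : F → ℂ} {b₀ : F} (hΦ : ∀ b, Φ (b + b₀) = Φ b)
    (hne : ψ (b₀ * ξ) ≠ 1) {B : Set F} (hBm : MeasurableSet B) (hB : ∀ b, b + b₀ ∈ B ↔ b ∈ B) :
    ∫ b in B, Φ b * ((ψ (b * ξ) : Circle) : ℂ) ∂μ = 0 := by
  classical
  have hper : ∀ b, B.indicator Φ (b + b₀) = B.indicator Φ b := fun b => by
    by_cases hb : b ∈ B
    · rw [Set.indicator_of_mem hb, Set.indicator_of_mem ((hB b).2 hb), hΦ b]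
    · rw [Set.indicator_of_notMem hb, Set.indicator_of_notMem (fun h => hb ((hB b).1 h))]
  have h := integral_mul_addChar_eq_zero_of_translate μ ψ ξ hper hne
  rw [← integral_indicator hBm]
  have hind : (fun b => B.indicator (fun b => Φ b * ((ψ (b * ξ) : Circle) : ℂ)) b) = fun b => B.indicator Φ b * ((ψ (b * ξ) : Circle) : ℂ) := by
    funext b
    by_cases hb : b ∈ B
    · rw [Set.indicator_of_mem hb, Set.indicator_of_mem hb]
    · rw [Set.indicator_of_notMem hb, Set.indicator_of_notMem hb, zero_mul]
  rw [hind]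
  exact h

/-- Support form of the ball version. [cite: Casselman1980, §3] -/
theorem addChar_eq_one_of_setIntegral_ne_zero (ψ : AddChar F Circle) (ξ : F) {Φ : F → ℂ} {B : Set F} (hBm : MeasurableSet B)
    (hI : ∫ b in B, Φ b * ((ψ (b * ξ) : Circle) : ℂ) ∂μ ≠ 0) {b₀ : F} (hΦ : ∀ b, Φ (b + b₀) = Φ b) (hB : ∀ b, b + b₀ ∈ B ↔ b ∈ B) :
    ψ (b₀ * ξ) = 1 := by
  by_contra hne
  exact hI (setIntegral_mul_addChar_eq_zero_of_translate μ ψ ξ hΦ hne hBm hB)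

end Vanishing

/-! ## §2 At `L⁺_v`: invariance under `𝔭^m` ⟹ the twist has `|ξ|_v ≤ exp(m − d)` -/

section Completion

variable {K : Type} [Field K] [NumberField K] (v : HeightOneSpectrum (𝓞 K))
  [MeasurableSpace (v.adicCompletion K)] [BorelSpace (v.adicCompletion K)] (μ : Measure (v.adicCompletion K)) [μ.IsAddRightInvariant]

/-- **THE RANK-ONE LATTICE LETTER.**  `Φ : K_v → ℂ` invariant under the translations of the ball `𝔭^m = {|b₀|_v ≤ exp(−m)}`, `ψ` of conductor exponent `d`, `μ` right-invariant:
`∫ Φ(b)·ψ(b·ξ) dμ ≠ 0 ⟹ |ξ|_v ≤ exp(m − d)` (§1 support form for every `b₀ ∈ 𝔭^m`, then ★ (c2) `v_le_exp_of_forall_apply_mul_eq_one`).  For the line: `Φ(b) = f_s(w₁·n(t(b))·g_v)`,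
`m = c_v + 2a` with `q^a = H(g_v)` (★ (c1)), output = the place-`v` half of `hlat` of ★ `hsupp_line_of_latticeLetter`. [cite: Casselman1980, §3] [cite: Shimura1997, §18] [cite: Tate1950, §2.2] -/
theorem v_le_exp_of_integral_mul_addChar_ne_zero {ψ : AddChar (v.adicCompletion K) Circle} {d : ℤ} (hψ : ψ.HasConductorExp d) (ξ : v.adicCompletion K)
    {Φ : v.adicCompletion K → ℂ} {m : ℤ} (hΦ : ∀ b₀ : v.adicCompletion K, Valued.v b₀ ≤ WithZero.exp (-m) → ∀ b, Φ (b + b₀) = Φ b)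
    (hI : ∫ b, Φ b * ((ψ (b * ξ) : Circle) : ℂ) ∂μ ≠ 0) : Valued.v ξ ≤ WithZero.exp (m - d) :=
  v_le_exp_of_forall_apply_mul_eq_one v hψ fun u hu => by
    rw [mul_comm]; exact addChar_eq_one_of_integral_ne_zero μ ψ ξ hI (hΦ u hu)

/-- **THE RANK-ONE LATTICE LETTER, BALL VERSION**: the same for `∫_B Φ(b)·ψ(b·ξ) dμ ≠ 0` over a measurable `B` stable under `𝔭^m` (every ball `{|b|_v ≤ exp k}`, `k ≥ −m`, is).
[cite: Casselman1980, §3] [cite: Shimura1997, §18] [cite: Tate1950, §2.2] -/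
theorem v_le_exp_of_setIntegral_mul_addChar_ne_zero {ψ : AddChar (v.adicCompletion K) Circle} {d : ℤ} (hψ : ψ.HasConductorExp d) (ξ : v.adicCompletion K)
    {Φ : v.adicCompletion K → ℂ} {m : ℤ} (hΦ : ∀ b₀ : v.adicCompletion K, Valued.v b₀ ≤ WithZero.exp (-m) → ∀ b, Φ (b + b₀) = Φ b)
    {B : Set (v.adicCompletion K)} (hBm : MeasurableSet B) (hB : ∀ b₀ : v.adicCompletion K, Valued.v b₀ ≤ WithZero.exp (-m) → ∀ b, b + b₀ ∈ B ↔ b ∈ B)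
    (hI : ∫ b in B, Φ b * ((ψ (b * ξ) : Circle) : ℂ) ∂μ ≠ 0) : Valued.v ξ ≤ WithZero.exp (m - d) :=
  v_le_exp_of_forall_apply_mul_eq_one v hψ fun u hu => by
    rw [mul_comm]; exact addChar_eq_one_of_setIntegral_ne_zero μ ψ ξ hBm hI (hΦ u hu) (hB u hu)

omit [MeasurableSpace (v.adicCompletion K)] [BorelSpace (v.adicCompletion K)] in
/-- The balls `{|b|_v ≤ exp k}` are stable under translation by `𝔭^m` when `−m ≤ k` (ultrametric inequality) — the `hB` letter of the ball version for Karel's truncation balls.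
[cite: Casselman1980, §3] [cite: WeilBNT1967, Ch. II §4] -/
theorem add_mem_ball_iff_of_v_le {m k : ℤ} (hmk : -m ≤ k) {b₀ : v.adicCompletion K} (hb₀ : Valued.v b₀ ≤ WithZero.exp (-m)) (b : v.adicCompletion K) :
    b + b₀ ∈ {b : v.adicCompletion K | Valued.v b ≤ WithZero.exp k} ↔ b ∈ {b : v.adicCompletion K | Valued.v b ≤ WithZero.exp k} := by
  have hb₀k : Valued.v b₀ ≤ WithZero.exp k := hb₀.trans (WithZero.exp_le_exp.2 hmk)
  simp only [Set.mem_setOf_eq]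
  constructor
  · intro h
    have h' : Valued.v b ≤ max (Valued.v (b + b₀)) (Valued.v (-b₀)) := by
      have h'' := Valuation.map_add Valued.v (b + b₀) (-b₀)
      rwa [add_neg_cancel_right] at h''
    rw [Valuation.map_neg] at h'
    exact h'.trans (max_le h hb₀k)
  · intro h
    exact (Valuation.map_add Valued.v b b₀).trans (max_le h hb₀k)

end Completion

end Summit.HodgeConjecture.HodgeConjecture.Cruxes.HLiu418.K2LiuKindOneLineLatticeLetter

end
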